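import Literature.NumberTheory.GaloisCohomology.PoitouTateSelmerCountProofs
import Literature.NumberTheory.GaloisRepresentations.ContinuousH1OrderTwo
import HarnessLib

/-!
# Poitou–Tate for Selmer structures, counting form — the case of ODD `n` (no condition at the infinite places)
# and the packaging with the named fact `poitouTate_selmerStructure_duality`

`Proofs` file (theorems only), topic `NumberTheory/GaloisCohomology`, sequel of `PoitouTateSelmerCountProofs.lean`
(`natCard_selmerQuotient_mul_of_poitouTate`: `#(H¹_𝓖/H¹_𝓕)(K,M) · #(H¹_{𝓕*}/H¹_{𝓖*})(K,M^D) · ∏_{v∈S_f} #𝓕_v =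
∏_{v∈S_f} #𝓖_v` for Selmer structures `𝓕 ≤ 𝓖` agreeing at the infinite places).  For ODD `n` the agreement at the
infinite places is automatic: `H¹(K_w, M) = 0` there for an `n`-torsion `M` (`2 · H¹(K_w, ·) = 0`,
`eq_zero_of_odd_nsmul_galoisCohomology_one_toLocal_inl`), so every local condition at `w ∣ ∞` is `⊥ = ⊤`.

* `SelmerStructure.apply_inl_eq_of_odd` — for odd `n` and `n · M = 0`, any two Selmer structures agree at every infinite place.
* `natCard_selmerQuotient_mul_of_poitouTate_of_odd` — the counting form without the hypothesis at `∞`.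
* `exists_localInvariants_natCard_selmerQuotient_mul_of_odd` — from the named fact `poitouTate_selmerStructure_duality K`:
  for odd `n` there is a family `inv` (perfect, with the Poitou–Tate vanishing, Milne I 2.6 and Howard 2.1.11) for which
  the product formula holds for every finite `n`-torsion `M`, `S`, `𝓕 ≤ 𝓖`.

HONEST FRAMING: kernel theorems over the tree's existing named fact; nothing booked (cell `bsd-potss`, seat `rkm` g16).
References: [MilneADT2006] Ch. I Thm. 4.10; [Howard2004HeegnerKolyvagin] Thm. 2.1.11; [SerreGaloisCohomology1997] I §2.4.
-/

noncomputable section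

open Function NumberField IsDedekindDomain
open scoped NumberField

universe u

namespace Literature.NumberTheory.GaloisCohomology

open Literature.NumberTheory.GaloisRepresentations
open Literature.NumberTheory.GaloisRepresentations.DiscreteGaloisModule (mu localTatePairingZMod tateDual
  SelmerStructure)

variable {K : Type u} [Field K] [NumberField K] {n : ℕ}
  {M : Type u} [AddCommGroup M] [TopologicalSpace M] [DiscreteTopology M] [Finite M]

omit [Finite M] in
/-- For ODD `n` and an `n`-torsion `M`, `H¹(K_w, M) = 0` at every infinite place `w`, so any two Selmer structures on `M`
agree there. [cite: SerreGaloisCohomology1997, I §2.4] -/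
theorem SelmerStructure.apply_inl_eq_of_odd (hn : Odd n) (ρ : DiscreteGaloisModule K M) (hM : ∀ m : M, n • m = 0)
    (𝓕 𝓖 : SelmerStructure ρ) (w : InfinitePlace K) : 𝓕 (Sum.inl w) = 𝓖 (Sum.inl w) := by
  have h0 : ∀ x : galoisCohomology (ρ.toLocal (Sum.inl w)) 1, x = 0 := fun x ↦
    eq_zero_of_odd_nsmul_galoisCohomology_one_toLocal_inl ρ w hn x
      (galoisCohomology.nsmul_eq_zero_of_forall _ hM x)
  ext x
  rw [h0 x]
  exact ⟨fun _ ↦ (𝓖 _).zero_mem, fun _ ↦ (𝓕 _).zero_mem⟩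

/-- **Poitou–Tate for Selmer structures, counting form, ODD `n`**: as `natCard_selmerQuotient_mul_of_poitouTate` without the
hypothesis at the infinite places. [cite: MilneADT2006, Ch. I, Thm. 4.10] [cite: Howard2004HeegnerKolyvagin, Thm. 2.1.11 (arXiv:1202.6340 p. 6)] -/
theorem natCard_selmerQuotient_mul_of_poitouTate_of_odd [NeZero n] (hn : Odd n) {inv : LocalInvariants K n}
    (hperf : inv.IsPerfect) (hvan : inv.SumLocalTermEqZero) (hcomp : inv.SelmerComplement)
    (ρ : DiscreteGaloisModule K M) (hM : ∀ m : M, n • m = 0) (S : Finset (Place K))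
    (hS : ∀ v : HeightOneSpectrum (𝓞 K), (Sum.inr v : Place K) ∉ S →
      ((n : ℕ) : 𝓞 K) ∉ v.asIdeal ∧ GaloisRep.IsUnramifiedAt v ρ)
    {𝓕 𝓖 : SelmerStructure ρ} (hle : 𝓕 ≤ 𝓖) (h𝓕 : 𝓕.IsUnramifiedOutside S) (h𝓖 : 𝓖.IsUnramifiedOutside S)
    (Sf : Finset (HeightOneSpectrum (𝓞 K))) (hSf : ∀ v, v ∈ Sf ↔ (Sum.inr v : Place K) ∈ S) :
    Nat.card (𝓖.selmerGroup ⧸ (𝓕.selmerGroup).addSubgroupOf 𝓖.selmerGroup) *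
      Nat.card ((inv.dualSelmerStructure ρ 𝓕).selmerGroup ⧸
        ((inv.dualSelmerStructure ρ 𝓖).selmerGroup).addSubgroupOf (inv.dualSelmerStructure ρ 𝓕).selmerGroup) *
      ∏ v ∈ Sf, Nat.card (𝓕 (Sum.inr v)) = ∏ v ∈ Sf, Nat.card (𝓖 (Sum.inr v)) :=
  natCard_selmerQuotient_mul_of_poitouTate hperf hvan hcomp ρ hM S hS hle h𝓕 h𝓖
    (fun w ↦ SelmerStructure.apply_inl_eq_of_odd hn ρ hM 𝓕 𝓖 w) Sf hSf

/-- **From the named fact**: under `poitouTate_selmerStructure_duality K`, for every odd `n ≥ 1` there is a family of local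
invariant maps — perfect, with the Poitou–Tate vanishing, Milne I Thm. 2.6 and Howard's Thm. 2.1.11 — for which the product
formula `#(H¹_𝓖/H¹_𝓕) · #(H¹_{𝓕*}/H¹_{𝓖*}) · ∏_{v∈S_f} #𝓕_v = ∏_{v∈S_f} #𝓖_v` holds for every finite `n`-torsion discrete
`Γ_K`-module, every admissible `S` and all Selmer structures `𝓕 ≤ 𝓖` unramified outside `S`.
[cite: MilneADT2006, Ch. I, Thm. 4.10] [cite: Howard2004HeegnerKolyvagin, Thm. 2.1.11 (arXiv:1202.6340 p. 6)] -/
theorem exists_localInvariants_natCard_selmerQuotient_mul_of_odd (h : poitouTate_selmerStructure_duality K)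
    (n : ℕ) [NeZero n] (hn : Odd n) :
    ∃ inv : LocalInvariants K n, inv.IsPerfect ∧ inv.SumLocalTermEqZero ∧ inv.UnramifiedOrthogonal ∧
      inv.SelmerComplement ∧
      ∀ ⦃M : Type u⦄ [AddCommGroup M] [TopologicalSpace M] [DiscreteTopology M] [Finite M]
        (ρ : DiscreteGaloisModule K M), (∀ m : M, n • m = 0) →
        ∀ (S : Finset (Place K)),
          (∀ v : HeightOneSpectrum (𝓞 K), (Sum.inr v : Place K) ∉ S →
            ((n : ℕ) : 𝓞 K) ∉ v.asIdeal ∧ GaloisRep.IsUnramifiedAt v ρ) →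
        ∀ (𝓕 𝓖 : SelmerStructure ρ), 𝓕 ≤ 𝓖 → 𝓕.IsUnramifiedOutside S → 𝓖.IsUnramifiedOutside S →
        ∀ (Sf : Finset (HeightOneSpectrum (𝓞 K))), (∀ v, v ∈ Sf ↔ (Sum.inr v : Place K) ∈ S) →
          Nat.card (𝓖.selmerGroup ⧸ (𝓕.selmerGroup).addSubgroupOf 𝓖.selmerGroup) *
            Nat.card ((inv.dualSelmerStructure ρ 𝓕).selmerGroup ⧸
              ((inv.dualSelmerStructure ρ 𝓖).selmerGroup).addSubgroupOf (inv.dualSelmerStructure ρ 𝓕).selmerGroup) *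
            ∏ v ∈ Sf, Nat.card (𝓕 (Sum.inr v)) = ∏ v ∈ Sf, Nat.card (𝓖 (Sum.inr v)) := by
  obtain ⟨inv, hperf, hvan, hunr, hcomp⟩ := h n
  exact ⟨inv, hperf, hvan, hunr, hcomp, fun M _ _ _ _ ρ hM S hS 𝓕 𝓖 hle h𝓕 h𝓖 Sf hSf ↦
    natCard_selmerQuotient_mul_of_poitouTate_of_odd hn hperf hvan hcomp ρ hM S hS hle h𝓕 h𝓖 Sf hSf⟩

end Literature.NumberTheory.GaloisCohomology

end
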